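import Mathlib

/-!
# Bookkeeping for sparse polynomials: reversal, shifts, derivatives, ranks of exponents (venture `DiscreteObjects`, target L)

Cell `pub-namedobj`, seat `pub-namedobj-mahler-g26`. Framing: lottery ticket; floor = certified bounds/negative ranges.

Elementary lemmas used by the cell's kernel REPLICATION of the Akhtari–Vaaler / Dobrowolski–Smyth bound
`M(f) ≥ |c_j| / binom(k-1, j)` for polynomials with `k` nonzero coefficients ([cite: MckeeSmyth2021, Theorem 11.4];
file `FewnomialHeightBound`): the Mahler measure is invariant under reversal (`mahlerMeasure_reverse`, via the
circle-average form of Mathlib's `Polynomial.logMahlerMeasure` and `z ↦ z⁻¹`) and under multiplication by `X^r`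
(`mahlerMeasure_X_pow`); the support of `X^r · g`, of `g'` (when `g(0) ≠ 0`, characteristic zero) and of
`reverse g` in terms of the support of `g`, with the number of nonzero coefficients and the RANK of an exponent
(`#{e ∈ supp : e < i}`) tracked through each operation; and `binom(n, r) ≤ 2^{n-1}` (`n ≥ 1`).  No new mathematics.
-/

namespace Summit.Ventures.DiscreteObjects.Mahler

open Polynomial

/-! ### `M(f.reverse) = M(f)` and `M(X^r) = 1` -/

/-- On the unit circle, `‖(reverse f)(z)‖ = ‖f(z⁻¹)‖`. -/
theorem norm_eval_reverse_of_norm_eq_one (f : ℂ[X]) {z : ℂ} (hz : ‖z‖ = 1) :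
    ‖eval z f.reverse‖ = ‖eval z⁻¹ f‖ := by
  have hz0 : z ≠ 0 := by
    rintro rfl
    simp at hz
  haveI : Invertible (z⁻¹) := invertibleOfNonzero (inv_ne_zero hz0)
  have h := eval₂_reverse_mul_pow (RingHom.id ℂ) z⁻¹ f
  rw [invOf_eq_inv, inv_inv, eval₂_id, eval₂_id] at h
  have := congrArg (fun w : ℂ => ‖w‖) h
  simp only [norm_mul, norm_pow, norm_inv, hz, inv_one, one_pow, mul_one] at this
  exact this

/-- **`M(reverse f) = M(f)`** (the circle average of `log ‖f‖` is invariant under `z ↦ z⁻¹`). -/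
theorem mahlerMeasure_reverse (f : ℂ[X]) : f.reverse.mahlerMeasure = f.mahlerMeasure := by
  by_cases hf : f = 0
  · simp [hf]
  have hr : f.reverse ≠ 0 := by rwa [Ne, reverse_eq_zero]
  have h1 : f.reverse.logMahlerMeasure = f.logMahlerMeasure := by
    rw [logMahlerMeasure_def, logMahlerMeasure_def]
    calc Real.circleAverage (fun x ↦ Real.log ‖eval x f.reverse‖) 0 1
        = Real.circleAverage (fun x ↦ Real.log ‖eval x⁻¹ f‖) 0 1 := by
          apply Real.circleAverage_congr_sphere
          intro x hx
          have hx1 : ‖x‖ = 1 := by simpa using hx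
          simp only [norm_eval_reverse_of_norm_eq_one f hx1]
      _ = Real.circleAverage (fun x ↦ Real.log ‖eval x f‖) 0 1 :=
          Real.circleAverage_zero_one_congr_inv (f := fun x => Real.log ‖eval x f‖)
  rw [← Real.exp_log (mahlerMeasure_pos_of_ne_zero hr), ← Real.exp_log (mahlerMeasure_pos_of_ne_zero hf),
    ← logMahlerMeasure_eq_log_MahlerMeasure, ← logMahlerMeasure_eq_log_MahlerMeasure, h1]

/-- `M(X^r) = 1`. -/
theorem mahlerMeasure_X_pow (r : ℕ) : ((X : ℂ[X]) ^ r).mahlerMeasure = 1 := by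
  have hne : (monomial r (1 : ℂ)) ≠ 0 := by simp
  rw [X_pow_eq_monomial, Polynomial.mahlerMeasure, if_pos hne, logMahlerMeasure_monomial, norm_one,
    Real.log_one, Real.exp_zero]

/-- `M(X^r · g) = M(g)`. -/
theorem mahlerMeasure_X_pow_mul (r : ℕ) (g : ℂ[X]) : (X ^ r * g).mahlerMeasure = g.mahlerMeasure := by
  rw [mahlerMeasure_mul, mahlerMeasure_X_pow, one_mul]

/-! ### Supports of `X^r · g`, `g'`, `reverse g` -/

/-- The support of `X^r · g` is the support of `g` shifted by `r`. -/
theorem support_X_pow_mul (r : ℕ) (g : ℂ[X]) : (X ^ r * g).support = g.support.map (addRightEmbedding r) := by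
  ext d
  simp only [mem_support_iff, Finset.mem_map, addRightEmbedding_apply, coeff_X_pow_mul']
  constructor
  · intro h
    by_cases hle : r ≤ d
    · rw [if_pos hle] at h
      exact ⟨d - r, h, Nat.sub_add_cancel hle⟩
    · rw [if_neg hle] at h
      exact absurd rfl h
  · rintro ⟨e, he, rfl⟩
    rw [if_pos (Nat.le_add_left r e), Nat.add_sub_cancel]
    exact he

/-- Multiplying by `X^r` does not change the number of nonzero coefficients. -/
theorem card_support_X_pow_mul_complex (r : ℕ) (g : ℂ[X]) : (X ^ r * g).support.card = g.support.card := by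
  rw [support_X_pow_mul, Finset.card_map]

/-- Multiplying by `X^r` does not change the rank of an exponent within the support. -/
theorem rank_X_pow_mul (r : ℕ) (g : ℂ[X]) (i : ℕ) :
    ((X ^ r * g).support.filter (· < i + r)).card = (g.support.filter (· < i)).card := by
  rw [support_X_pow_mul, Finset.filter_map, Finset.card_map]
  congr 1
  apply Finset.filter_congr
  intro e _
  simp only [Function.comp_apply, addRightEmbedding_apply]
  omega

/-- If `g(0) ≠ 0`: the support of `g` is `{0}` together with the support of `g'` shifted up by one (char. 0). -/
theorem support_eq_insert_map_derivative (g : ℂ[X]) (h0 : g.coeff 0 ≠ 0) :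
    g.support = insert 0 (g.derivative.support.map ⟨fun n => n + 1, add_left_injective 1⟩) := by
  ext n
  rw [Finset.mem_insert, Finset.mem_map]
  constructor
  · intro hn
    rcases Nat.eq_zero_or_pos n with h | h
    · exact Or.inl h
    · right
      refine ⟨n - 1, ?_, ?_⟩
      · rw [mem_support_derivative, Nat.sub_add_cancel h]
        exact hn
      · show n - 1 + 1 = n
        exact Nat.sub_add_cancel h
  · rintro (rfl | ⟨m, hm, rfl⟩)
    · exact mem_support_iff.2 h0
    · exact mem_support_derivative.1 hm

/-- If `g(0) ≠ 0`, the derivative has exactly one nonzero coefficient fewer. -/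
theorem card_support_derivative_add_one (g : ℂ[X]) (h0 : g.coeff 0 ≠ 0) :
    g.derivative.support.card + 1 = g.support.card := by
  rw [support_eq_insert_map_derivative g h0, Finset.card_insert_of_notMem (by simp), Finset.card_map]

/-- If `g(0) ≠ 0` and `0 < i`: the rank of `i - 1` in the support of `g'` is one less than the rank of `i` in the
support of `g` (the constant term, of rank `0`, disappears). -/
theorem rank_derivative_add_one (g : ℂ[X]) (h0 : g.coeff 0 ≠ 0) {i : ℕ} (hi : 0 < i) :
    (g.derivative.support.filter (· < i - 1)).card + 1 = (g.support.filter (· < i)).card := by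
  rw [support_eq_insert_map_derivative g h0, Finset.filter_insert, if_pos hi,
    Finset.card_insert_of_notMem (by simp), Finset.filter_map, Finset.card_map]
  congr 2
  apply Finset.filter_congr
  intro e _
  simp only [Function.comp_apply, Function.Embedding.coeFn_mk]
  omega

/-- Reversal permutes the nonzero coefficients: same number. -/
theorem card_support_reverse (f : ℂ[X]) : f.reverse.support.card = f.support.card := by
  unfold reverse
  rw [reflect_support, Finset.card_image_of_injective _ (revAt f.natDegree).injective]

/-- The rank of `N - i` in the support of `reverse g` counts the exponents of `g` ABOVE `i` (`N = deg g`). -/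
theorem rank_reverse (g : ℂ[X]) (i : ℕ) (hi : i ≤ g.natDegree) :
    (g.reverse.support.filter (· < g.natDegree - i)).card = (g.support.filter (i < ·)).card := by
  unfold reverse
  rw [reflect_support, Finset.filter_image, Finset.card_image_of_injective _ (revAt g.natDegree).injective]
  congr 1
  apply Finset.filter_congr
  intro e he
  have heN : e ≤ g.natDegree := le_natDegree_of_mem_supp e he
  rw [revAt_le heN]
  omega

/-- Rank below + the exponent itself + rank above = number of nonzero coefficients. -/
theorem rank_add_rank_above_add_one {g : ℂ[X]} {i : ℕ} (hi : i ∈ g.support) :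
    (g.support.filter (· < i)).card + (g.support.filter (i < ·)).card + 1 = g.support.card := by
  have h := Finset.card_filter_add_card_filter_not (s := g.support) (fun e => e < i)
  have h2 : (g.support.filter fun e => ¬ e < i) = insert i (g.support.filter (i < ·)) := by
    ext e
    simp only [Finset.mem_filter, Finset.mem_insert]
    constructor
    · rintro ⟨he, hne⟩
      rcases Nat.eq_or_lt_of_le (not_lt.1 hne) with h | h
      · exact Or.inl h.symm
      · exact Or.inr ⟨he, h⟩
    · rintro (rfl | ⟨he, h⟩)
      · exact ⟨hi, lt_irrefl _⟩
      · exact ⟨he, by omega⟩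
  rw [h2, Finset.card_insert_of_notMem (by simp)] at h
  omega

/-- The rank of a member of the support is less than the number of nonzero coefficients. -/
theorem rank_lt_card {g : ℂ[X]} {i : ℕ} (hi : i ∈ g.support) :
    (g.support.filter (· < i)).card < g.support.card := by
  have := rank_add_rank_above_add_one hi
  omega

/-! ### A binomial estimate -/

/-- `binom(n, r) ≤ 2^{n-1}` for `n ≥ 1`. -/
theorem choose_le_two_pow_pred {n : ℕ} (hn : 1 ≤ n) (r : ℕ) : n.choose r ≤ 2 ^ (n - 1) := by
  induction n, hn using Nat.le_induction generalizing r with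
  | base =>
    rcases r with _ | r
    · simp
    · rw [Nat.choose_succ_succ', Nat.choose_zero_succ, add_zero]
      rcases r with _ | r
      · simp
      · simp
  | succ n hn ih =>
    rcases r with _ | r
    · simp [Nat.one_le_two_pow]
    · rw [Nat.choose_succ_succ', show n + 1 - 1 = (n - 1) + 1 by omega, pow_succ]
      have h1 := ih r
      have h2 := ih (r + 1)
      omega

end Summit.Ventures.DiscreteObjects.Mahler
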